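import Mathlib
import HarnessLib.Audit
import Summits.PneNP.PneNP.Theorems.PstarGateCaseTPrivateTouch
import Summits.PneNP.PneNP.Theorems.PstarGateCaseTPrivateCycleQuad

/-!
# One GATED chord, CASE T: a private edge of the gated cycle carries a CROSS GATE (E2 node N4X; prover-1 g20)

FRONTIER range-avoidance ladder, rung F-N3 (`stmt-PneNP-19007`), cell `pnp-ideate` (`PstarGateNodesX.GateCaseTQuadX`); restricted-model proof
complexity — nothing here bears on `P` versus `NP`.

CASE T with another chord; `π ∈ D e` a `u`-avoiding tree edge private within `J₀ ∪ {g₀}` (AND pair `α, α'`), and a SECOND `u`-avoiding edge of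
`D e` (so that the chamber `H₁ = {x_u = κ₀+1}` carries points with `u_e = 0` and with `u_e = 1` after pinning `x_{α'} = 0` or `x_α = 0`).  By
the touch lemma (`PstarGateCaseTPrivateTouch.caseT_private_touch`) one of `q_mv`, `q_{(1,0)}` reads `α` or `α'` beyond `π`'s monomial.  Such an
extra read is the affine function `D(y) = Q(y + e_β) + Q(y) + τ·y_{β'}`; it VANISHES on `S₀(β) = H₁ ∩ Z(u_e) ∩ {y_{β'} = 0}` for `Q = q_{(1,0)}`
(the OFF-region pin `caseT_off_q`) and on `S₁(β) = H₁ ∩ {u_e = 1} ∩ {y_{β'} = 0}` for `Q = q_mv` (`caseT_q_zero_of_on`); both sets are non-empty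
and closed under flipping any coordinate outside `{u} ∪ ⋃_{j ∈ D e} andPair j`, so `D`'s linear part vanishes on those coordinates; on `u` and on
the AND variables of the other edges of `D e` it is the indicator of a private-free GATE with AND pair `{z, β}` (`polarDir_basis`; a join edge
with that pair would be `π` itself) — a CROSS gate.  If no cross gate touches `π`, `D ≡ 0` for all four choices, contradicting the touch lemma:

* `shift_eq_of_vanish` — MODEL: a quadratic whose `e_β`-shift vanishes on a non-empty set closed under the flips outside `Z`, with prescribed
  polar values on `Z`, has `Q(y + e_β) = Q(y) + τ·y_{β'}` everywhere;
* `polarDir_basis` — `polarDir mv (e_c, e_d)` as join/gate AND-adjacency indicators;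
* `caseT_private_cross` — **some gate `o ∈ G₁ ∪ G₂` has one AND variable in `andPair π` and the other equal to `u` or in the AND pair of
  another edge of `D e`.**
-/

set_option linter.dupNamespace false -- `Summit.PneNP.PneNP.…`: summit = sub-problem name (D-0017 single-conjunct layout)

open Finset Module Literature.Computability.Complexity
open scoped symmDiff
open Summit.PneNP.PneNP.Theorems.PstarTyped (Typed)
open Summit.PneNP.PneNP.Theorems.PstarSALevel (varSet bdry BoundaryExpanding SimpleOverlap)
open Summit.PneNP.PneNP.Theorems.PstarGapLinearised (andPair andPair_subset_varSet)
open Summit.PneNP.PneNP.Theorems.PstarChordEndgameTools (mem_andPair_iff)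
open Summit.PneNP.PneNP.Theorems.PstarCentreFree (vars_mem_varSet)
open Summit.PneNP.PneNP.Theorems.PstarProductRank (qform polar)
open Summit.PneNP.PneNP.Theorems.PstarPathRank (AndAdj polar_basis)
open Summit.PneNP.PneNP.Theorems.PstarReadSumset (V2)
open Summit.PneNP.PneNP.Theorems.PstarChordSystem (ChordSystem)
open Summit.PneNP.PneNP.Theorems.PstarChordBridgeTools (privs coef)
open Summit.PneNP.PneNP.Theorems.PstarChordBridge (BridgeData sys)
open Summit.PneNP.PneNP.Theorems.PstarChordBridgeForcing (gam sys_u_eq freeMon freePolar)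
open Summit.PneNP.PneNP.Theorems.PstarChordBridgeBasis (qDir polarDir)
open Summit.PneNP.PneNP.Theorems.PstarChordBridgeCorner (qDir_add andAdj_iff_mem)
open Summit.PneNP.PneNP.Theorems.PstarNorUnitEQ1Tools (polarDir_single_pair)
open Summit.PneNP.PneNP.Theorems.PstarChordBridgeNor (polarDir_comm)
open Summit.PneNP.PneNP.Theorems.PstarGateBridge (GateHyp)
open Summit.PneNP.PneNP.Theorems.PstarGateHyperplane (qform_single_and)
open Summit.PneNP.PneNP.Theorems.PstarGateCaseTLocal (u_add)
open Summit.PneNP.PneNP.Theorems.PstarGateNodes (GateData)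
open Summit.PneNP.PneNP.Theorems.PstarGateNodesX (GateDataX)
open Summit.PneNP.PneNP.Theorems.PstarGateU2Joins (polar_single_off)
open Summit.PneNP.PneNP.Theorems.PstarGateCaseTOffQ (caseT_off_q)
open Summit.PneNP.PneNP.Theorems.PstarGateCaseTRankSix (sigma_const)
open Summit.PneNP.PneNP.Theorems.PstarGateCaseTPrivateCycleQuad (caseT_q_zero_of_on)
open Summit.PneNP.PneNP.Theorems.PstarGateCaseTPrivateTouch (u_flip_fst u_flip_snd caseT_private_touch)

namespace Summit.PneNP.PneNP.Theorems.PstarGateCaseTPrivateCross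

variable {n m : ℕ}

/-! ## Model: an extra read that vanishes on a rich set vanishes everywhere -/

/-- **MODEL.**  See the module docstring. -/
theorem shift_eq_of_vanish {Q : (Fin n → ZMod 2) → ZMod 2} {P : LinearMap.BilinForm (ZMod 2) (Fin n → ZMod 2)}
    (hQ : ∀ x w, Q (x + w) = Q x + Q w + Q 0 + P x w) {β β' : Fin n} (τ : ZMod 2)
    {S : Set (Fin n → ZMod 2)} (hne : S.Nonempty) (hS0 : ∀ y ∈ S, y β' = 0) (hSQ : ∀ y ∈ S, Q (y + Pi.single β 1) = Q y)
    (Z : Finset (Fin n)) (hZ : ∀ z ∈ Z, P (Pi.single z 1) (Pi.single β 1) = if z = β' then τ else 0)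
    (hcl : ∀ z ∉ Z, ∀ y ∈ S, y + Pi.single z 1 ∈ S) :
    ∀ y, Q (y + Pi.single β 1) = Q y + τ * y β' := by
  classical
  set eβ : Fin n → ZMod 2 := Pi.single β 1 with heβ
  -- the extra read and its linear part
  set D : (Fin n → ZMod 2) → ZMod 2 := fun y => Q (y + eβ) + Q y + τ * y β' with hDdef
  have hPsym : ∀ v w, P v w = P w v := fun v w => PstarQuadRank.polar_symm hQ v w
  set L : (Fin n → ZMod 2) →ₗ[ZMod 2] ZMod 2 := P eβ + τ • LinearMap.proj β' with hLdef
  have hL : ∀ v, L v = P v eβ + τ * v β' := fun v => by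
    simp only [hLdef, LinearMap.add_apply, LinearMap.smul_apply, LinearMap.proj_apply, smul_eq_mul]
    rw [hPsym]
  have hD : ∀ y v, D (y + v) = D y + L v := by
    intro y v
    simp only [hDdef, hL]
    have h1 : Q (y + v + eβ) = Q (y + v) + Q eβ + Q 0 + P (y + v) eβ := hQ _ _
    have h2 : Q (y + eβ) = Q y + Q eβ + Q 0 + P y eβ := hQ _ _
    rw [h1, h2, map_add, LinearMap.add_apply, Pi.add_apply]
    generalize Q (y + v) = a1; generalize Q eβ = a2; generalize Q 0 = a3; generalize P y eβ = a4; generalize P v eβ = a5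
    generalize Q y = a6; generalize y β' = a7; generalize v β' = a8
    revert a1 a2 a3 a4 a5 a6 a7 a8; generalize τ = t; revert t; decide
  have hDS : ∀ y ∈ S, D y = 0 := by
    intro y hy
    simp only [hDdef]
    rw [hSQ y hy, hS0 y hy, mul_zero, add_zero, CharTwo.add_self_eq_zero]
  obtain ⟨y₀, hy₀⟩ := hne
  -- `L` vanishes on every basis vector
  have hLz : ∀ z, L (Pi.single z 1) = 0 := by
    intro z
    by_cases hz : z ∈ Z
    · rw [hL, hZ z hz]
      by_cases hzb : z = β'
      · subst hzb; rw [if_pos rfl, Pi.single_eq_same, mul_one]; exact CharTwo.add_self_eq_zero τ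
      · rw [if_neg hzb, Pi.single_eq_of_ne (Ne.symm hzb), mul_zero, add_zero]
    · have h := hD y₀ (Pi.single z 1)
      rw [hDS y₀ hy₀, hDS _ (hcl z hz y₀ hy₀), zero_add] at h
      exact h.symm
  have hL0 : L = 0 := by
    refine LinearMap.pi_ext fun z t => ?_
    rw [LinearMap.zero_apply]
    have : (Pi.single z t : Fin n → ZMod 2) = t • Pi.single z 1 := by
      rw [← Pi.single_smul', smul_eq_mul, mul_one]
    rw [this, map_smul, hLz, smul_zero]
  intro y
  have hy : y = y₀ + (y + y₀) := by
    ext i; rw [Pi.add_apply, Pi.add_apply]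
    generalize y i = a; generalize y₀ i = b; revert a b; decide
  have h := hD y₀ (y + y₀)
  rw [← hy, hL0, LinearMap.zero_apply, add_zero, hDS y₀ hy₀] at h
  simp only [hDdef] at h
  have e3 : ∀ a b c : ZMod 2, a + b + c = 0 → a = b + c := by decide
  exact e3 _ _ _ h

/-! ## The polar form of a direction on basis vectors -/

/-- `polarDir mv (e_c, e_d)` as AND-adjacency indicators of the joins and of the private-free gates. -/
theorem polarDir_basis (I : LocalMap 4 n m) (hI : I.IsPure xorAndPred) (hS : SimpleOverlap I) (B : BridgeData n m) (mv : V2) (c d : Fin n) :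
    polarDir I B mv (Pi.single c 1) (Pi.single d 1) =
      mv.2 * ((if AndAdj I B.T₁ c d then 1 else 0) + (if AndAdj I (freeMon I B.N B.G₁) c d then 1 else 0)) +
      mv.1 * ((if AndAdj I B.T₂ c d then 1 else 0) + (if AndAdj I (freeMon I B.N B.G₂) c d then 1 else 0)) := by
  unfold PstarChordBridgeBasis.polarDir PstarChordBridgeForcing.freePolar
  rw [LinearMap.add_apply, LinearMap.add_apply, LinearMap.smul_apply, LinearMap.smul_apply, LinearMap.smul_apply, LinearMap.smul_apply,
    LinearMap.add_apply, LinearMap.add_apply, LinearMap.add_apply, LinearMap.add_apply,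
    polar_basis I hI hS, polar_basis I hI hS, polar_basis I hI hS, polar_basis I hI hS, smul_eq_mul, smul_eq_mul]

section CaseT

variable (I : LocalMap 4 n m) (hI : I.IsPure xorAndPred) (hT : Typed I) (hS : SimpleOverlap I) {r₀ : ℕ} (hB : BoundaryExpanding r₀ I)
  {B : BridgeData n m} {e g₀ : Fin m} {u : Fin n} {κ₀ : ZMod 2} (hD : GateDataX I r₀ B e g₀ u κ₀) {mv : V2} (hmvT : mv = (0, 1) ∨ mv = (1, 1))
  (hP : ∀ e' ∈ B.N, e' ≠ e → ∀ a, ((sys I B).ρ e' a = 0 ∨ (sys I B).ρ e' a = mv) ∧ ((sys I B).ρ' e' a = 0 ∨ (sys I B).ρ' e' a = mv))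
  (hread : ∀ e' ∈ B.N, e' ≠ e → ∀ a, (sys I B).ρ e' a ≠ 0 ∨ (sys I B).ρ' e' a ≠ 0) (hN : (B.N.erase e).Nonempty)
  {π : Fin m} (hπD : π ∈ B.D e) (hπ2 : I.vars π 2 ≠ u) (hπ3 : I.vars π 3 ≠ u)
  (hpriv : ∀ j' ∈ insert g₀ B.J₀, j' ≠ π → I.vars π 2 ∉ varSet I j' ∧ I.vars π 3 ∉ varSet I j')
  {k : Fin m} (hkD : k ∈ B.D e) (hkπ : k ≠ π) (hk2 : I.vars k 2 ≠ u) (hk3 : I.vars k 3 ≠ u)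
include hI hT hS hB hD hmvT hP hread hN hπD hπ2 hπ3 hpriv hkD hkπ hk2 hk3

/-- **A private edge of the gated cycle carries a cross gate.**  See the module docstring. -/
theorem caseT_private_cross : ∃ o ∈ B.G₁ ∪ B.G₂,
    (I.vars o 2 ∈ andPair I π ∧ (I.vars o 3 = u ∨ ∃ j ∈ (B.D e).erase π, I.vars o 3 ∈ andPair I j)) ∨
    (I.vars o 3 ∈ andPair I π ∧ (I.vars o 2 = u ∨ ∃ j ∈ (B.D e).erase π, I.vars o 2 ∈ andPair I j)) := by
  classical
  by_contra hnc
  have hon_q : ∀ {x : Fin n → ZMod 2}, x u = κ₀ + 1 → (sys I B).u e x = 1 → qDir I B mv x = 0 :=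
    fun hxu hue => caseT_q_zero_of_on I hI hT hS hB hD hmvT hP hread hN hxu hue
  obtain ⟨hXc, hW, hr, hd₁, hd₂, hL, -, -, hG, hg₀, hgv, -⟩ := id hD
  have he : e ∈ B.N := hG.1
  have hUα := fun (y : Fin n → ZMod 2) => u_flip_fst I hI hT hS hB hD hmvT hP hread hπD hπ2 hπ3 hpriv he y
  have hUα' := fun (y : Fin n → ZMod 2) => u_flip_snd I hI hT hS hB hD hmvT hP hread hπD hπ2 hπ3 hpriv he y
  have hπJ : π ∈ B.J₀ := (mem_sdiff.1 (hW.hD e he hπD)).1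
  have hDeJ : B.D e ⊆ B.J₀ := fun j hj => (mem_sdiff.1 (hW.hD e he hj)).1
  have h23 : I.vars π 2 ≠ I.vars π 3 := fun h => absurd (hI.2 π h) (by decide)
  set α := I.vars π 2 with hα
  set α' := I.vars π 3 with hα'
  -- the OFF-region pin of `q_{(1,0)}` on the chamber
  have hoff : ∀ y : Fin n → ZMod 2, y u = κ₀ + 1 → (sys I B).u e y = 0 →
      qDir I B (1, 0) y = 1 + ∑ i ∈ B.N.erase e, (((sys I B).ρ i 0).2 + ((sys I B).ρ' i 0).2) := by
    intro y hyu hUy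
    have h := caseT_off_q I hI hT hD hmvT hP hread hyu hUy
    rw [sigma_const I hW hG] at h
    exact h
  -- the special coordinates and the closure of the chamber sets under the other flips
  set Z : Finset (Fin n) := insert u ((B.D e).biUnion (andPair I)) with hZdef
  have hαZ : α ∈ Z := mem_insert_of_mem (mem_biUnion.2 ⟨π, hπD, (mem_andPair_iff I π _).2 (Or.inl rfl)⟩)
  have hα'Z : α' ∈ Z := mem_insert_of_mem (mem_biUnion.2 ⟨π, hπD, (mem_andPair_iff I π _).2 (Or.inr rfl)⟩)
  have hU0 : ∀ v : Fin n, (sys I B).u e (Pi.single v 1) = (sys I B).u e 0 := by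
    intro v; rw [sys_u_eq, sys_u_eq, qform_single_and I hI]; unfold qform; simp
  have hflipZ : ∀ z ∉ Z, ∀ y : Fin n → ZMod 2, (sys I B).u e (y + Pi.single z 1) = (sys I B).u e y := by
    intro z hz y
    have hzD : z ∉ (B.D e).biUnion (andPair I) := fun h => hz (mem_insert_of_mem h)
    rw [u_add I B e, PstarPathRank.polar_symm_and I (B.D e), polar_single_off I (B.D e) hzD, hU0]
    generalize (sys I B).u e y = s; generalize (sys I B).u e 0 = t; revert s t; decide
  have hzu : ∀ z ∉ Z, z ≠ u := fun z hz h => hz (h ▸ mem_insert_self _ _)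
  -- the sets `S_c(β)`
  let Sset : ZMod 2 → Fin n → Set (Fin n → ZMod 2) := fun c b' => {y | y u = κ₀ + 1 ∧ (sys I B).u e y = c ∧ y b' = 0}
  have hcl : ∀ c b', b' ∈ Z → ∀ z ∉ Z, ∀ y ∈ Sset c b', y + Pi.single z 1 ∈ Sset c b' := by
    intro c b' hb' z hz y hy
    obtain ⟨h1, h2, h3⟩ := hy
    refine ⟨?_, ?_, ?_⟩
    · rw [Pi.add_apply, h1, Pi.single_eq_of_ne (Ne.symm (hzu z hz)), add_zero]
    · rw [hflipZ z hz, h2]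
    · rw [Pi.add_apply, h3, Pi.single_eq_of_ne (fun h => hz (by rw [← h]; exact hb')), add_zero]
  -- richness: both values of `u_e` occur on the chamber with `x_{b'} = 0`, for `b' ∈ {α, α'}` (flip the other avoiding edge `k`)
  have hkα : ∀ {b'}, b' = α ∨ b' = α' → I.vars k 2 ≠ b' ∧ I.vars k 3 ≠ b' := by
    intro b' hb'
    have hp := hpriv k (mem_insert_of_mem (hDeJ hkD)) hkπ
    rcases hb' with rfl | rfl
    · exact ⟨fun h => hp.1 (h ▸ vars_mem_varSet I k 2), fun h => hp.1 (h ▸ vars_mem_varSet I k 3)⟩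
    · exact ⟨fun h => hp.2 (h ▸ vars_mem_varSet I k 2), fun h => hp.2 (h ▸ vars_mem_varSet I k 3)⟩
  have hrich : ∀ c : ZMod 2, ∀ {b'}, b' = α ∨ b' = α' → (Sset c b').Nonempty := by
    intro c b' hb'
    have hbu : b' ≠ u := by rcases hb' with rfl | rfl <;> assumption
    obtain ⟨hc2, hc3⟩ := hkα hb'
    set y₀ : Fin n → ZMod 2 := Pi.single u (κ₀ + 1) with hy₀
    set ec : Fin n → ZMod 2 := Pi.single (I.vars k 2) 1 with hec
    set ed : Fin n → ZMod 2 := Pi.single (I.vars k 3) 1 with hed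
    have hpol : polar (B.D e) (fun j => I.vars j 2) (fun j => I.vars j 3) ec ed = 1 := by
      rw [hec, hed, polar_basis I hI hS, if_pos ((andAdj_iff_mem I hI hS (B.D e) k).2 hkD)]
    have hUU := u_add I B e
    have hq4 : (sys I B).u e (y₀ + ec + ed) = (sys I B).u e (y₀ + ec) + (sys I B).u e (y₀ + ed) + (sys I B).u e y₀ + 1 := by
      have h1 := hUU (y₀ + ec) ed
      have h2 := hUU y₀ ed
      rw [map_add, LinearMap.add_apply] at h1
      rw [h1, h2, hpol]
      generalize (sys I B).u e (y₀ + ec) = a; generalize (sys I B).u e y₀ = b; generalize (sys I B).u e ed = c'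
      generalize (sys I B).u e 0 = d; generalize polar (B.D e) (fun j => I.vars j 2) (fun j => I.vars j 3) y₀ ed = s
      revert a b c' d s; decide
    have mem : ∀ y : Fin n → ZMod 2, y u = κ₀ + 1 → y b' = 0 → (sys I B).u e y = c → (Sset c b').Nonempty := fun y h1 h3 h2 => ⟨y, h1, h2, h3⟩
    have hy₀u : y₀ u = κ₀ + 1 := by rw [hy₀, Pi.single_eq_same]
    have hy₀b : y₀ b' = 0 := by rw [hy₀, Pi.single_eq_of_ne hbu]
    have hcu : ec u = 0 := by rw [hec, Pi.single_eq_of_ne (Ne.symm hk2)]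
    have hdu : ed u = 0 := by rw [hed, Pi.single_eq_of_ne (Ne.symm hk3)]
    have hcb : ec b' = 0 := by rw [hec, Pi.single_eq_of_ne (Ne.symm hc2)]
    have hdb : ed b' = 0 := by rw [hed, Pi.single_eq_of_ne (Ne.symm hc3)]
    by_contra hno
    have z01 : ∀ t c' : ZMod 2, t ≠ c' → t = c' + 1 := by decide
    have f0 := z01 _ c (fun h => hno (mem y₀ hy₀u hy₀b h))
    have f1 := z01 _ c (fun h => hno (mem (y₀ + ec) (by rw [Pi.add_apply, hy₀u, hcu, add_zero]) (by rw [Pi.add_apply, hy₀b, hcb, add_zero]) h))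
    have f2 := z01 _ c (fun h => hno (mem (y₀ + ed) (by rw [Pi.add_apply, hy₀u, hdu, add_zero]) (by rw [Pi.add_apply, hy₀b, hdb, add_zero]) h))
    have f3 := z01 _ c (fun h => hno (mem (y₀ + ec + ed) (by rw [Pi.add_apply, Pi.add_apply, hy₀u, hcu, hdu, add_zero, add_zero])
      (by rw [Pi.add_apply, Pi.add_apply, hy₀b, hcb, hdb, add_zero, add_zero]) h))
    rw [f0, f1, f2, f3] at hq4
    have e1 : ∀ c' : ZMod 2, c' + 1 = c' + 1 + (c' + 1) + (c' + 1) + 1 → False := by decide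
    exact e1 c hq4
  -- AND-adjacency with one of `π`'s variables, for `z ∈ Z`: a join edge would be `π`, a gate would be cross
  have hT_adj : ∀ T ⊆ B.J₀, ∀ z ∈ Z, ∀ {b b'}, (b = α ∧ b' = α') ∨ (b = α' ∧ b' = α) → AndAdj I T z b → z = b' ∧ π ∈ T := by
    intro T hTJ z hz b b' hbb hadj
    obtain ⟨j, hjT, hj⟩ := hadj
    have hbj : b ∈ andPair I j := by
      rcases hj with ⟨-, h3⟩ | ⟨h2, -⟩
      · exact (mem_andPair_iff I j b).2 (Or.inr h3.symm)
      · exact (mem_andPair_iff I j b).2 (Or.inl h2.symm)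
    have hjπ : j = π := by
      by_contra hne
      have hp := hpriv j (mem_insert_of_mem (hTJ hjT)) hne
      rcases hbb with ⟨rfl, -⟩ | ⟨rfl, -⟩
      · exact hp.1 (andPair_subset_varSet I j hbj)
      · exact hp.2 (andPair_subset_varSet I j hbj)
    subst hjπ
    refine ⟨?_, hjT⟩
    rcases hbb with ⟨hb, hb'⟩ | ⟨hb, hb'⟩ <;> subst hb hb'
    · rcases hj with ⟨-, h3⟩ | ⟨-, h3⟩
      · exact absurd h3.symm h23
      · exact h3.symm
    · rcases hj with ⟨h2, -⟩ | ⟨h2, -⟩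
      · exact h2.symm
      · exact absurd h2 h23
  have hG_adj : ∀ G, (G = B.G₁ ∨ G = B.G₂) → ∀ z ∈ Z, ∀ {b}, b = α ∨ b = α' → ¬ AndAdj I (freeMon I B.N G) z b := by
    intro G hG z hz b hb hadj
    obtain ⟨o, hoG, ho⟩ := hadj
    have hoG' : o ∈ B.G₁ ∪ B.G₂ := by
      have h := (mem_filter.1 hoG).1
      rcases hG with rfl | rfl
      · exact mem_union_left _ h
      · exact mem_union_right _ h
    have hbπ : b ∈ andPair I π := by
      rcases hb with rfl | rfl
      exacts [(mem_andPair_iff I π _).2 (Or.inl rfl), (mem_andPair_iff I π _).2 (Or.inr rfl)]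
    -- `z ∈ Z`: `z = u` or `z` is an AND variable of an edge of `D e`; that edge is not `π` (else `o` shares two variables with `π`)
    have hzalt : z = u ∨ ∃ j ∈ (B.D e).erase π, z ∈ andPair I j := by
      rw [hZdef, mem_insert, mem_biUnion] at hz
      rcases hz with h | ⟨j, hjD, hzj⟩
      · exact Or.inl h
      · right
        refine ⟨j, mem_erase.2 ⟨fun hjπ => ?_, hjD⟩, hzj⟩
        subst hjπ
        -- `o` and `π` share `z` and `b`, two distinct variables
        have hzb : z ≠ b := by
          rcases ho with ⟨h2, h3⟩ | ⟨h2, h3⟩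
          · rw [← h2, ← h3]; exact fun h => absurd (hI.2 o h) (by decide)
          · rw [← h2, ← h3]; exact fun h => absurd (hI.2 o h.symm) (by decide)
        have hoπ : o ≠ j := by
          intro h
          have hoJ : o ∈ B.J₀ := h ▸ hπJ
          rcases hG with rfl | rfl
          · exact disjoint_left.1 hd₁ (mem_filter.1 hoG).1 hoJ
          · exact disjoint_left.1 hd₂ (mem_filter.1 hoG).1 hoJ
        have hzo : z ∈ varSet I o := by
          rcases ho with ⟨h2, -⟩ | ⟨-, h3⟩
          exacts [h2 ▸ vars_mem_varSet I o 2, h3 ▸ vars_mem_varSet I o 3]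
        have hbo : b ∈ varSet I o := by
          rcases ho with ⟨-, h3⟩ | ⟨h2, -⟩
          exacts [h3 ▸ vars_mem_varSet I o 3, h2 ▸ vars_mem_varSet I o 2]
        exact PstarChordEndgameTools.not_two_shared I hS hoπ hzb hzo (andPair_subset_varSet I j hzj) hbo (andPair_subset_varSet I j hbπ)
    rcases ho with ⟨h2, h3⟩ | ⟨h2, h3⟩
    · -- `vars o 2 = z`, `vars o 3 = b`
      exact hnc ⟨o, hoG', Or.inr ⟨by rw [h3]; exact hbπ, by rw [h2]; exact hzalt⟩⟩
    · exact hnc ⟨o, hoG', Or.inl ⟨by rw [h2]; exact hbπ, by rw [h3]; exact hzalt⟩⟩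
  -- the polar values on `Z`
  have hpolZ : ∀ (mv' : V2) (T₁' : B.T₁ ⊆ B.J₀) (T₂' : B.T₂ ⊆ B.J₀), ∀ z ∈ Z, ∀ {b b'}, (b = α ∧ b' = α') ∨ (b = α' ∧ b' = α) →
      polarDir I B mv' (Pi.single z 1) (Pi.single b 1) =
        if z = b' then polarDir I B mv' (Pi.single α 1) (Pi.single α' 1) else 0 := by
    intro mv' T₁' T₂' z hz b b' hbb
    have hb : b = α ∨ b = α' := by rcases hbb with ⟨h, -⟩ | ⟨h, -⟩ <;> [exact Or.inl h; exact Or.inr h]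
    rw [polarDir_basis I hI hS B mv' z b, if_neg (hG_adj B.G₁ (Or.inl rfl) z hz hb), if_neg (hG_adj B.G₂ (Or.inr rfl) z hz hb), add_zero,
      add_zero]
    by_cases hzb : z = b'
    · subst hzb
      rw [if_pos rfl, hα, hα', polarDir_single_pair I hI hS hd₁ hd₂ mv' hπJ]
      have hA : ∀ T ⊆ B.J₀, (AndAdj I T z b ↔ π ∈ T) := by
        intro T hTJ
        refine ⟨fun h => (hT_adj T hTJ z hz hbb h).2, fun h => ⟨π, h, ?_⟩⟩
        rcases hbb with ⟨rfl, rfl⟩ | ⟨rfl, rfl⟩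
        · exact Or.inr ⟨rfl, rfl⟩
        · exact Or.inl ⟨rfl, rfl⟩
      simp only [hA B.T₁ T₁', hA B.T₂ T₂']
    · rw [if_neg hzb]
      have hA : ∀ T ⊆ B.J₀, ¬ AndAdj I T z b := fun T hTJ h => hzb (hT_adj T hTJ z hz hbb h).1
      rw [if_neg (hA B.T₁ T₁'), if_neg (hA B.T₂ T₂'), mul_zero, mul_zero, add_zero]
  have hT₁J : B.T₁ ⊆ B.J₀ := hW.hT₁.trans sdiff_subset
  have hT₂J : B.T₂ ⊆ B.J₀ := hW.hT₂.trans sdiff_subset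
  -- the four identities, contradicting the touch lemma
  refine caseT_private_touch I hI hT hS hB hD hmvT hP hread hπD hπ2 hπ3 hpriv fun y => ⟨?_, ?_, ?_, ?_⟩
  · -- `q_mv`, flip `α`: vanishes on `S₁(α)`
    refine shift_eq_of_vanish (qDir_add I B mv) _ (hrich 1 (Or.inr rfl)) (fun y hy => hy.2.2) (fun y hy => ?_) Z
      (fun z hz => hpolZ mv hT₁J hT₂J z hz (Or.inl ⟨rfl, rfl⟩)) (hcl 1 α' hα'Z) y
    obtain ⟨h1, h2, h3⟩ := hy
    rw [hon_q h1 h2, hon_q (by rw [Pi.add_apply, h1, Pi.single_eq_of_ne (Ne.symm hπ2), add_zero]) (by rw [hUα y, h2, h3, add_zero])]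
  · -- `q_mv`, flip `α'`
    have h := shift_eq_of_vanish (qDir_add I B mv) _ (hrich 1 (Or.inl rfl)) (fun y hy => hy.2.2) (fun y hy => ?_) Z
      (fun z hz => hpolZ mv hT₁J hT₂J z hz (Or.inr ⟨rfl, rfl⟩)) (hcl 1 α hαZ) y
    · rw [h, polarDir_comm]
    obtain ⟨h1, h2, h3⟩ := hy
    rw [hon_q h1 h2, hon_q (by rw [Pi.add_apply, h1, Pi.single_eq_of_ne (Ne.symm hπ3), add_zero]) (by rw [hUα' y, h2, h3, add_zero])]
  · -- `q_{(1,0)}`, flip `α`: vanishes on `S₀(α)`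
    refine shift_eq_of_vanish (qDir_add I B (1, 0)) _ (hrich 0 (Or.inr rfl)) (fun y hy => hy.2.2) (fun y hy => ?_) Z
      (fun z hz => hpolZ (1, 0) hT₁J hT₂J z hz (Or.inl ⟨rfl, rfl⟩)) (hcl 0 α' hα'Z) y
    obtain ⟨h1, h2, h3⟩ := hy
    rw [hoff y h1 h2, hoff _ (by rw [Pi.add_apply, h1, Pi.single_eq_of_ne (Ne.symm hπ2), add_zero]) (by rw [hUα y, h2, h3, add_zero])]
  · -- `q_{(1,0)}`, flip `α'`
    have h := shift_eq_of_vanish (qDir_add I B (1, 0)) _ (hrich 0 (Or.inl rfl)) (fun y hy => hy.2.2) (fun y hy => ?_) Z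
      (fun z hz => hpolZ (1, 0) hT₁J hT₂J z hz (Or.inr ⟨rfl, rfl⟩)) (hcl 0 α hαZ) y
    · rw [h, polarDir_comm]
    obtain ⟨h1, h2, h3⟩ := hy
    rw [hoff y h1 h2, hoff _ (by rw [Pi.add_apply, h1, Pi.single_eq_of_ne (Ne.symm hπ3), add_zero]) (by rw [hUα' y, h2, h3, add_zero])]

end CaseT

end Summit.PneNP.PneNP.Theorems.PstarGateCaseTPrivateCross
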